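import Mathlib
import HarnessLib
import Summits.NavierStokesRegularity.NavierStokesRegularity.Theorems.TypeIQuarterGateScarEnvelopeTypeIForcedTsaiSemantics

/-!
# ARM B lane E-exact — FIELD CALCULUS of the witness (towards stubs S1/S2): partial derivatives of
  sparse polynomials and of the Gaussian along the coordinate directions; the curl of the witness field

* `Mono.fderiv_eval_single`, `QPoly.fderiv_eval_single` — `∂_j` of the value of a (sparse) polynomial is
  the value of its symbolic derivative `QPoly.deriv j`;
* `eval_tPoly`, `gauss_eq_exp_tPoly`, `fderiv_gauss_single` — `∂_j e^{−b|y|²} = −2b y_j e^{−b|y|²}`;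
* `eval_Dg` — the value of `Dg b j P` is `∂_jP − 2b y_j P`;
* `fderiv_field_single` — `∂_j U_i = e^{−a|y|²}·(Dg a j u_i)(y)` for the witness field `U = e^{−a|y|²}·u`;
* `curl_field` — **stub S2 DISCHARGED**: `curl U y = e^{−a|y|²}·(curl_a u)(y)`.
Nothing here bears on NS regularity.
-/

noncomputable section

set_option linter.dupNamespace false

namespace Summit.NavierStokesRegularity.NavierStokesRegularity.Cruxes.ScarEnvelopeTypeI.ForcedTsai

open MeasureTheory Set Metric Real
open scoped RealInnerProductSpace ContDiff
open Literature.Analysis.FluidPDE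

/-! ## Coordinates -/

-- (the coordinate derivative `HasFDerivAt (fun y => y i) (EuclideanSpace.proj i) y` is
-- `(EuclideanSpace.proj i).hasFDerivAt`; a named copy exists as `…Theorems.Bachani2026.hasFDerivAt_coord`)

/-- `e_j · i`-th coordinate. -/
theorem proj_single (i j : Fin 3) :
    (EuclideanSpace.proj i : E3 →L[ℝ] ℝ) (EuclideanSpace.single j (1 : ℝ)) = if i = j then 1 else 0 := by
  simp

/-! ## Monomials and sparse polynomials -/

/-- Value of the symbolic partial derivative of a monomial (`0` if the variable is absent). -/
def Mono.pd (j : Fin 3) (m : Mono) (y : E3) : ℝ :=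
  match Mono.deriv j m with
  | none => 0
  | some m' => Mono.eval m' y

/-- Monomials are differentiable. -/
theorem Mono.differentiableAt_eval (m : Mono) (y : E3) : DifferentiableAt ℝ (fun y : E3 => Mono.eval m y) y := by
  have h0 := ((EuclideanSpace.proj (0 : Fin 3) : E3 →L[ℝ] ℝ).hasFDerivAt (x := y)).differentiableAt
  have h1 := ((EuclideanSpace.proj (1 : Fin 3) : E3 →L[ℝ] ℝ).hasFDerivAt (x := y)).differentiableAt
  have h2 := ((EuclideanSpace.proj (2 : Fin 3) : E3 →L[ℝ] ℝ).hasFDerivAt (x := y)).differentiableAt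
  unfold Mono.eval
  exact ((h0.pow _ |>.const_mul _).mul (h1.pow _)).mul (h2.pow _)

/-- Closed form of `Mono.pd 0`. -/
theorem Mono.pd_zero (m : Mono) (y : E3) :
    Mono.pd 0 m y = (m.c : ℝ) * m.e1 * y 0 ^ (m.e1 - 1) * y 1 ^ m.e2 * y 2 ^ m.e3 := by
  unfold Mono.pd Mono.deriv
  by_cases he : m.e1 = 0
  · simp [he]
  · obtain ⟨k, hk⟩ := Nat.exists_eq_succ_of_ne_zero he
    simp [Mono.eval, hk]

/-- Closed form of `Mono.pd 1`. -/
theorem Mono.pd_one (m : Mono) (y : E3) :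
    Mono.pd 1 m y = (m.c : ℝ) * m.e2 * y 0 ^ m.e1 * y 1 ^ (m.e2 - 1) * y 2 ^ m.e3 := by
  unfold Mono.pd Mono.deriv
  by_cases he : m.e2 = 0
  · simp [he]
  · obtain ⟨k, hk⟩ := Nat.exists_eq_succ_of_ne_zero he
    simp [Mono.eval, hk]

/-- Closed form of `Mono.pd 2`. -/
theorem Mono.pd_two (m : Mono) (y : E3) :
    Mono.pd 2 m y = (m.c : ℝ) * m.e3 * y 0 ^ m.e1 * y 1 ^ m.e2 * y 2 ^ (m.e3 - 1) := by
  unfold Mono.pd Mono.deriv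
  by_cases he : m.e3 = 0
  · simp [he]
  · obtain ⟨k, hk⟩ := Nat.exists_eq_succ_of_ne_zero he
    simp [Mono.eval, hk]

/-- The Fréchet derivative of a monomial's value, in closed form. -/
theorem Mono.hasFDerivAt_eval (m : Mono) (y : E3) :
    HasFDerivAt (fun y : E3 => Mono.eval m y)
      (Mono.pd 0 m y • (EuclideanSpace.proj 0 : E3 →L[ℝ] ℝ) + Mono.pd 1 m y • (EuclideanSpace.proj 1 : E3 →L[ℝ] ℝ) +
        Mono.pd 2 m y • (EuclideanSpace.proj 2 : E3 →L[ℝ] ℝ)) y := by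
  have h0 := (EuclideanSpace.proj (0 : Fin 3) : E3 →L[ℝ] ℝ).hasFDerivAt (x := y)
  have h1 := (EuclideanSpace.proj (1 : Fin 3) : E3 →L[ℝ] ℝ).hasFDerivAt (x := y)
  have h2 := (EuclideanSpace.proj (2 : Fin 3) : E3 →L[ℝ] ℝ).hasFDerivAt (x := y)
  have hm : HasFDerivAt (fun y : E3 => Mono.eval m y) _ y :=
    (((h0.pow m.e1).const_mul (m.c : ℝ)).mul (h1.pow m.e2)).mul (h2.pow m.e3)
  refine hm.congr_fderiv ?_
  ext v
  simp [Mono.pd_zero, Mono.pd_one, Mono.pd_two]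
  ring

/-- `∂_j` of a monomial's value is the value of its symbolic derivative. -/
theorem Mono.fderiv_eval_single (m : Mono) (y : E3) (j : Fin 3) :
    fderiv ℝ (fun y : E3 => Mono.eval m y) y (EuclideanSpace.single j 1) = Mono.pd j m y := by
  rw [(m.hasFDerivAt_eval y).fderiv]
  fin_cases j <;> simp

/-- Sparse polynomials are differentiable. -/
theorem QPoly.differentiableAt_eval (P : QPoly) (y : E3) : DifferentiableAt ℝ (fun y : E3 => QPoly.eval P y) y := by
  induction P with
  | nil => simp
  | cons m P ih =>
    have : (fun y : E3 => QPoly.eval (m :: P) y) = fun y => Mono.eval m y + QPoly.eval P y := by funext y; simp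
    rw [this]; exact (Mono.differentiableAt_eval m y).add ih

/-- The symbolic derivative of a cons, at the value level. -/
theorem QPoly.eval_deriv_cons (j : Fin 3) (m : Mono) (P : QPoly) (y : E3) :
    QPoly.eval (QPoly.deriv j (m :: P)) y = Mono.pd j m y + QPoly.eval (QPoly.deriv j P) y := by
  unfold QPoly.deriv Mono.pd
  rw [List.filterMap_cons]
  cases Mono.deriv j m with
  | none => simp
  | some m' => simp

/-- `∂_j` of a sparse polynomial's value is the value of `QPoly.deriv j`. -/
theorem QPoly.fderiv_eval_single (P : QPoly) (y : E3) (j : Fin 3) :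
    fderiv ℝ (fun y : E3 => QPoly.eval P y) y (EuclideanSpace.single j 1) = QPoly.eval (QPoly.deriv j P) y := by
  induction P with
  | nil => simp [QPoly.deriv]
  | cons m P ih =>
    have hfun : (fun y : E3 => QPoly.eval (m :: P) y) = (fun y => Mono.eval m y) + fun y => QPoly.eval P y := by
      funext y; simp
    rw [hfun, fderiv_add (Mono.differentiableAt_eval m y) (QPoly.differentiableAt_eval P y)]
    simp only [FunLike.coe_add, Pi.add_apply]
    rw [Mono.fderiv_eval_single, ih, QPoly.eval_deriv_cons]

/-! ## The Gaussian -/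

/-- `tPoly` is `|y|²`. -/
theorem eval_tPoly (y : E3) : QPoly.eval tPoly y = ‖y‖ ^ 2 := by
  rw [EuclideanSpace.real_norm_sq_eq, Fin.sum_univ_three]
  simp [QPoly.eval, tPoly, Mono.eval]
  ring

/-- `∂_j |y|² = 2 y_j` at the symbolic level. -/
theorem eval_deriv_tPoly (j : Fin 3) (y : E3) : QPoly.eval (QPoly.deriv j tPoly) y = 2 * y j := by
  fin_cases j <;> simp [QPoly.deriv, tPoly, Mono.deriv, QPoly.eval, Mono.eval]

/-- The Gaussian through `tPoly`. -/
theorem gauss_eq (b : ℝ) : gauss b = fun y => Real.exp (-b * QPoly.eval tPoly y) := by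
  funext y; rw [gauss, eval_tPoly]

/-- The Gaussian is differentiable. -/
theorem differentiableAt_gauss (b : ℝ) (y : E3) : DifferentiableAt ℝ (gauss b) y := by
  rw [gauss_eq]
  exact (((QPoly.differentiableAt_eval tPoly y).const_mul (-b)).exp)

/-- `∂_j e^{−b|y|²} = −2b y_j e^{−b|y|²}`. -/
theorem fderiv_gauss_single (b : ℝ) (y : E3) (j : Fin 3) :
    fderiv ℝ (gauss b) y (EuclideanSpace.single j 1) = -2 * b * y j * gauss b y := by
  rw [gauss_eq]
  have hd : DifferentiableAt ℝ (fun y : E3 => -b * QPoly.eval tPoly y) y :=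
    (QPoly.differentiableAt_eval tPoly y).const_mul (-b)
  rw [fderiv_exp hd, fderiv_const_mul (QPoly.differentiableAt_eval tPoly y)]
  simp only [FunLike.coe_smul, Pi.smul_apply, smul_eq_mul]
  rw [QPoly.fderiv_eval_single, eval_deriv_tPoly]
  ring

/-! ## The witness field -/

/-- Value of the Gaussian-rate symbolic derivative: `(Dg b j P)(y) = (∂_jP)(y) − 2b y_j P(y)`. -/
theorem eval_Dg (b : ℚ) (j : Fin 3) (P : QPoly) (y : E3) :
    QPoly.eval (Dg b j P) y = QPoly.eval (QPoly.deriv j P) y - 2 * (b : ℝ) * y j * QPoly.eval P y := by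
  simp only [Dg, QPoly.eval_add, QPoly.eval_scale, QPoly.eval_mulVar]; push_cast; ring

namespace WitnessRow

/-- Components of the witness field. -/
theorem field_apply (r : WitnessRow) (y : E3) (i : Fin 3) :
    r.field y i = gauss r.aR y * QPoly.eval (r.u i) y := by
  simp [WitnessRow.field, evalVec, PiLp.smul_apply]

/-- Components of the witness field are differentiable. -/
theorem differentiableAt_field_apply (r : WitnessRow) (y : E3) (i : Fin 3) :
    DifferentiableAt ℝ (fun y => r.field y i) y := by
  have : (fun y => r.field y i) = fun y => gauss r.aR y * QPoly.eval (r.u i) y := by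
    funext y; exact r.field_apply y i
  rw [this]; exact (differentiableAt_gauss _ y).mul (QPoly.differentiableAt_eval _ y)

/-- The witness field is differentiable. -/
theorem differentiableAt_field (r : WitnessRow) (y : E3) : DifferentiableAt ℝ r.field y :=
  differentiableAt_euclidean.mpr fun i => r.differentiableAt_field_apply y i

/-- The cast of the rate. -/
theorem cast_a (r : WitnessRow) : ((r.a : ℚ) : ℝ) = r.aR := by
  unfold WitnessRow.a WitnessRow.aR; push_cast; ring

/-- `∂_j U_i = e^{−a|y|²}·(Dg a j u_i)(y)`. -/
theorem fderiv_field_single (r : WitnessRow) (y : E3) (i j : Fin 3) :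
    fderiv ℝ r.field y (EuclideanSpace.single j 1) i = gauss r.aR y * QPoly.eval (Dg r.a j (r.u i)) y := by
  -- component extraction through the projection
  have hcomp : fderiv ℝ r.field y (EuclideanSpace.single j 1) i =
      fderiv ℝ (fun y => r.field y i) y (EuclideanSpace.single j 1) := by
    have h := ((EuclideanSpace.proj i : E3 →L[ℝ] ℝ).hasFDerivAt.comp y (r.differentiableAt_field y).hasFDerivAt)
    have h' : fderiv ℝ (fun y => r.field y i) y = (EuclideanSpace.proj i : E3 →L[ℝ] ℝ) ∘L fderiv ℝ r.field y := by
      have : (fun y => r.field y i) = (EuclideanSpace.proj i : E3 →L[ℝ] ℝ) ∘ r.field := by funext y; rfl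
      rw [this]; exact h.fderiv
    rw [h']; rfl
  rw [hcomp]
  have hfun : (fun y => r.field y i) = (gauss r.aR) * fun y => QPoly.eval (r.u i) y := by
    funext y; exact r.field_apply y i
  rw [hfun, fderiv_mul (differentiableAt_gauss _ y) (QPoly.differentiableAt_eval _ y)]
  simp only [FunLike.coe_add, FunLike.coe_smul, Pi.add_apply, Pi.smul_apply, smul_eq_mul]
  rw [fderiv_gauss_single, QPoly.fderiv_eval_single, eval_Dg, r.cast_a]
  ring

/-- **S2 (DISCHARGED): the curl of the witness field is `e^{−a|y|²}·ω`, `ω = curl_a u`.** -/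
theorem curl_field (r : WitnessRow) (y : E3) : curl r.field y = gauss r.aR y • evalVec r.om y := by
  have hD : ∀ i j : Fin 3, fderiv ℝ r.field y (EuclideanSpace.single j 1) i =
      gauss r.aR y * QPoly.eval (Dg r.a j (r.u i)) y := fun i j => r.fderiv_field_single y i j
  ext k
  rw [PiLp.smul_apply, smul_eq_mul]
  simp only [curl, evalVec, WitnessRow.om, curlG, PiLp.toLp_apply]
  fin_cases k
  · simp only [Fin.zero_eta, Fin.isValue, Matrix.cons_val_zero, hD, QPoly.eval_norm, QPoly.eval_sub]
    ring
  · simp only [Fin.mk_one, Fin.isValue, Matrix.cons_val_one, Matrix.cons_val_zero, hD, QPoly.eval_norm,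
      QPoly.eval_sub]
    ring
  · simp only [Fin.reduceFinMk, Fin.isValue, Matrix.cons_val, hD, QPoly.eval_norm, QPoly.eval_sub]
    ring

end WitnessRow

end Summit.NavierStokesRegularity.NavierStokesRegularity.Cruxes.ScarEnvelopeTypeI.ForcedTsai

end
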